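import Mathlib
import HarnessLib
import Summits.ResolutionOfSingularities.ResolutionOfSingularities.Theses.CleanCovers
import Literature.AlgebraicGeometry.Resolution.LogRegularSchemeEtale
import Literature.AlgebraicGeometry.Resolution.QuasiProjectiveReduction
import Literature.AlgebraicGeometry.Resolution.AlterationsLemma32
import Literature.AlgebraicGeometry.Resolution.ComponentGluing

/-!
# Crux `CleanCovers.CoverResolution` (stmt-ResolutionOfSingularities-15104): the local/global split
# on the base, at the level of log-regular (toric) models — ASSEMBLY THEOREM

Route `ResolutionOfSingularities/CleanCovers`, crux-strategist seat
`planner-cstrat-stmt-ResolutionOfSingularities-15104-r1-0` (2026-08-17, BC2 redirect of the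
RESTATED deciding crux). `CoverResolution` (every integral `X` finite surjective over `ℙⁿ_k`, `k`
perfect of characteristic `p`, étale over the chart `D₊(xₙ) ≅ 𝔸ⁿ`, has a resolution) is equivalent
to the summit over perfect fields (Kedlaya 2004, Thm. 1). This file PROVES that it follows from
three pieces, each strictly weaker than it (two are consequences of the summit and open, one is a
known theorem), so that the route's leaves become the pieces and `CoverResolution` is DERIVED
(`ledger route edit … --split CoverResolution`, glue = this theorem):

* **P1 `BoundaryLogRegularization`** (crux; the cleaning engine's LOCAL output, on the base): every
  point `h` of `ℙⁿ_k` off the chart (i.e. on the hyperplane at infinity `H = V₊(xₙ)`) has an open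
  neighbourhood `B ⊆ ℙⁿ_k` such that `f⁻¹(B)` admits a proper birational `Y → f⁻¹(B)` with `Y` log
  regular for some finite atlas of fs étale charts (`Scheme.IsLogRegularEtale`, Nizioł 2006
  Def. 2.2 / Kato 1994 (2.1)) — "locally on the base along `H`, a Kedlaya cover is dominated by
  toric singularities". Implied by the summit (a resolution restricted to `f⁻¹(B)` is such a
  model: regular ⇒ log regular); does not imply it (no patching).
* **P3 `LogRegularPatching`** (crux; Zariski's patching problem, at the toric level, over base
  opens): if `f⁻¹(B₁)` and `f⁻¹(B₂)` admit proper birational log-regular models then so does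
  `f⁻¹(B₁ ∪ B₂)`. Implied by the summit; open in dimension `≥ 4` (Piltant 2013 p. 2; the
  `DimensionFourFrontier` barrier entry), and not known to imply it (no local input).
* **P2 `LogRegularResolution`** (support; KNOWN: Nizioł 2006 Cor. 5.7, Kato 1994 (10.4); the typed
  form of the route's informal item `LogRegularResolutionGlobal`, stmt-15118): a quasi-compact
  scheme that is log regular for fs étale charts has a resolution (`Scheme.HasResolution`).
  Vendored as the named fact
  `Literature.AlgebraicGeometry.Resolution.Niziol2006_logRegularScheme_hasResolution`; closing the
  item is formalising Nizioł §§4–5 / Kato §§9–10.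

**Assembly (`coverResolution_of_subs : P1 → P3 → P2 → CoverResolution`), proof.** Fix a Kedlaya
cover `f : X → ℙⁿ_k`. (1) The chart part `f⁻¹(D₊(xₙ))` is étale over the regular scheme `D₊(xₙ)`
(`smooth_isSeparated_quasiCompact_isRegular_opens_projectiveSpace`), hence regular (étale ⇒ smooth,
EGA IV₄ 17.5.8 (iii), `Scheme.IsRegular.of_smooth`), hence its own log-regular model (identity,
trivial log structure, Kato (2.2)(1)). (2) With P1, EVERY point of `ℙⁿ_k` has an open
neighbourhood over which the cover has a proper birational log-regular model. (3) `ℙⁿ_k` is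
quasi-compact (proper over `Spec k`), so finitely many such neighbourhoods cover it; (4) induction
over the finite subcover with P3 produces a proper birational log-regular model `π : Y → X` of
`f⁻¹(ℙⁿ_k) = X` (through `⊤ ≅ X`); (5) `X` is quasi-compact (finite over `ℙⁿ_k`) and so is `Y`
(proper over `X`), so P2 resolves `Y`, and resolutions descend along proper birational morphisms
(`Scheme.HasResolution.of_isBirational`, `of_iso`). About 70 lines of Lean; axioms `propext`,
`Classical.choice`, `Quot.sound`; no named fact is used (P2 is a HYPOTHESIS, not the vendored
fact). The three hypotheses are stated VERBATIM as the children's one-line Props (they do not exist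
as route decls before the split), exactly as the gate will render them.

BC2 probes (seat folder `bc/*_probe.lean`, farm rc 1 each): for each piece `Pi`, both
`Pi → _root_.ResolutionOfSingularities` and `Pi → CoverResolution` FAIL under
`first | exact? | simpa [Pi] | (unfold Pi; simpa) | aesop` (unsolved goals after exhaustive aesop
search, or heartbeat timeout at 400000), and so do the converses (recorded). No `def`s here.
-/

set_option linter.dupNamespace false -- mandated namespace of this single-conjunct summit

namespace Summit.ResolutionOfSingularities.ResolutionOfSingularities.Theorems

open CategoryTheory AlgebraicGeometry TopologicalSpace
open Literature.AlgebraicGeometry.Resolution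
open Summit.ResolutionOfSingularities.ResolutionOfSingularities.Theses.CleanCovers

universe u

/-! ## Two bookkeeping lemmas -/

/-- A regular locally Noetherian scheme is its own log-regular proper birational model: the
identity is proper and birational (over `U = ⊤`), and a regular locally Noetherian scheme is log
regular for the trivial log structure (Kato 1994 (2.2)(1)), a fortiori for étale charts.
[cite: Kato1994, (2.2)(1)] -/
theorem exists_logRegularModel_of_isRegular (Z : Scheme.{u}) [IsLocallyNoetherian Z]
    (h : Scheme.IsRegular Z) :
    ∃ (Y : Scheme.{u}) (π : Y ⟶ Z), IsProper π ∧ IsBirational π ∧ Scheme.IsLogRegularEtale Y := by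
  refine ⟨Z, 𝟙 Z, inferInstance, ⟨⊤, ?_, ?_, ?_⟩, h.isLogRegular.isLogRegularEtale⟩
  · simp
  · simp
  · infer_instance

/-- Membership in a finite supremum of opens: `z ∈ s.sup U ↔ ∃ i ∈ s, z ∈ U i`. [folklore] -/
theorem mem_finset_sup_opens {Z : Scheme.{u}} {ι : Type*} (s : Finset ι) (U : ι → Z.Opens) (z : Z) :
    z ∈ s.sup U ↔ ∃ i ∈ s, z ∈ U i := by
  classical
  induction s using Finset.induction_on with
  | empty => simp
  | insert a t hat ih =>
    rw [Finset.sup_insert, Opens.mem_sup, ih]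
    constructor
    · rintro (h | ⟨i, hi, hz⟩)
      · exact ⟨a, Finset.mem_insert_self a t, h⟩
      · exact ⟨i, Finset.mem_insert_of_mem hi, hz⟩
    · rintro ⟨i, hi, hz⟩
      rcases Finset.mem_insert.mp hi with rfl | hi
      · exact Or.inl hz
      · exact Or.inr ⟨i, hi, hz⟩

/-! ## The assembly -/

/-- **ASSEMBLY of the crux-strategist split of `CoverResolution`** (BC2 redirect): base-local
log-regular models along the hyperplane at infinity (P1 `BoundaryLogRegularization`), patching of
log-regular models over two base opens (P3 `LogRegularPatching`) and resolution of quasi-compact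
log-regular schemes (P2 `LogRegularResolution`, Nizioł 2006 Cor. 5.7) together give
`CoverResolution`. The chart part `f⁻¹(𝔸ⁿ)` is regular (étale over regular), `ℙⁿ_k` is
quasi-compact, the finitely many local models are patched by induction over a finite subcover of
the base, and the resolution of the global model descends along the proper birational `Y → X`.
Shape `C₁ → C₂ → C₃ → C` for `ledger route edit --split CoverResolution`. [folklore] -/
theorem coverResolution_of_subs :
    (∀ p : ℕ, p.Prime → ∀ (k : Type) [Field k] [CharP k p] [PerfectField k] (n : ℕ) (X : AlgebraicGeometry.Scheme.{0}) (f : X ⟶ (Literature.AlgebraicGeometry.Motives.projectiveSpace n k).left), AlgebraicGeometry.IsIntegral X → AlgebraicGeometry.IsFinite f → Function.Surjective f.base → (letI := MvPolynomial.gradedAlgebra (σ := Fin (n + 1)) (R := k); AlgebraicGeometry.Etale (f ∣_ (AlgebraicGeometry.Proj.basicOpen (MvPolynomial.homogeneousSubmodule (Fin (n + 1)) k) (MvPolynomial.X (Fin.last n))))) → ∀ h : (Literature.AlgebraicGeometry.Motives.projectiveSpace n k).left, (letI := MvPolynomial.gradedAlgebra (σ := Fin (n + 1)) (R := k); h ∉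 AlgebraicGeometry.Proj.basicOpen (MvPolynomial.homogeneousSubmodule (Fin (n + 1)) k) (MvPolynomial.X (Fin.last n))) → ∃ B : (Literature.AlgebraicGeometry.Motives.projectiveSpace n k).left.Opens, h ∈ B ∧ ∃ (Y : AlgebraicGeometry.Scheme.{0}) (π : Y ⟶ ((f ⁻¹ᵁ B : X.Opens) : AlgebraicGeometry.Scheme.{0})), AlgebraicGeometry.IsProper π ∧ Literature.AlgebraicGeometry.Resolution.IsBirational π ∧ Literature.AlgebraicGeometry.Resolution.Scheme.IsLogRegularEtale Y) →
    (∀ p : ℕ, p.Prime → ∀ (k : Type) [Field k] [CharP k p] [PerfectField k] (n : ℕ) (X : AlgebraicGeometry.Scheme.{0}) (f : X ⟶ (Literature.AlgebraicGeometry.Motives.projectiveSpace n k).left), AlgebraicGeometry.IsIntegral X → AlgebraicGeometry.IsFinite f → Function.Surjective f.base → (letI := MvPolynomial.gradedAlgebra (σ := Fin (n + 1)) (R := k); AlgebraicGeometry.Etale (f ∣_ (AlgebraicGeometry.Proj.basicOpen (MvPolynomial.homogeneousSubmodule (Fin (n + 1)) k) (MvPolynomial.X (Fin.last n))))) → ∀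 B₁ B₂ : (Literature.AlgebraicGeometry.Motives.projectiveSpace n k).left.Opens, (∃ (Y : AlgebraicGeometry.Scheme.{0}) (π : Y ⟶ ((f ⁻¹ᵁ B₁ : X.Opens) : AlgebraicGeometry.Scheme.{0})), AlgebraicGeometry.IsProper π ∧ Literature.AlgebraicGeometry.Resolution.IsBirational π ∧ Literature.AlgebraicGeometry.Resolution.Scheme.IsLogRegularEtale Y) → (∃ (Y : AlgebraicGeometry.Scheme.{0}) (π : Y ⟶ ((f ⁻¹ᵁ B₂ : X.Opens) : AlgebraicGeometry.Scheme.{0})), AlgebraicGeometry.IsProper π ∧ Literature.AlgebraicGeometry.Resolution.IsBirational π ∧ Literature.AlgebraicGeometry.Resolution.Scheme.IsLogRegularEtale Y) → ∃ (Y : AlgebraicGeometry.Scheme.{0}) (π : Y ⟶ ((f ⁻¹ᵁ (B₁ ⊔ B₂) : X.Opens) : AlgebraicGeometry.Scheme.{0})), AlgebraicGeometry.IsProper π ∧ Literature.AlgebraicGeometry.Resolution.IsBirational π ∧ Literature.AlgebraicGeometry.Resolution.Scheme.IsLogRegularEtale Y) →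
    (∀ (Y : AlgebraicGeometry.Scheme.{0}), CompactSpace Y → Literature.AlgebraicGeometry.Resolution.Scheme.IsLogRegularEtale Y → Literature.AlgebraicGeometry.Resolution.Scheme.HasResolution Y) →
    CoverResolution := by
  intro hP1 hP3 hP2 p hp k _ _ _ n X f hint hfin hsurj het
  letI := MvPolynomial.gradedAlgebra (σ := Fin (n + 1)) (R := k)
  haveI := hfin
  -- the chart `A = D_+(x_n) ⊆ P^n_k`
  set A : (Literature.AlgebraicGeometry.Motives.projectiveSpace n k).left.Opens :=
    AlgebraicGeometry.Proj.basicOpen (MvPolynomial.homogeneousSubmodule (Fin (n + 1)) k)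
      (MvPolynomial.X (Fin.last n)) with hA
  haveI hAet : Etale (f ∣_ A) := het
  -- Noetherian / compactness bookkeeping
  haveI : IsProper (Literature.AlgebraicGeometry.Motives.projectiveSpace n k).hom :=
    Literature.AlgebraicGeometry.Motives.isProper_projectiveSpace n k
  haveI hPN : IsLocallyNoetherian (Literature.AlgebraicGeometry.Motives.projectiveSpace n k).left :=
    LocallyOfFiniteType.isLocallyNoetherian (Literature.AlgebraicGeometry.Motives.projectiveSpace n k).hom
  haveI hPc : CompactSpace (Literature.AlgebraicGeometry.Motives.projectiveSpace n k).left :=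
    QuasiCompact.compactSpace_of_compactSpace (Literature.AlgebraicGeometry.Motives.projectiveSpace n k).hom
  haveI hXN : IsLocallyNoetherian X := LocallyOfFiniteType.isLocallyNoetherian f
  haveI hXc : CompactSpace X := QuasiCompact.compactSpace_of_compactSpace f
  -- Step 1: the chart part `f ⁻¹ A` is étale over the regular scheme `A`, hence regular,
  -- hence its own log-regular model.
  have hAreg : Scheme.IsRegular (A : Scheme.{0}) :=
    (smooth_isSeparated_quasiCompact_isRegular_opens_projectiveSpace n A).2.2.2
  have hfAreg : Scheme.IsRegular ((f ⁻¹ᵁ A : X.Opens) : Scheme.{0}) :=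
    Scheme.IsRegular.of_smooth (f ∣_ A) hAreg
  -- Step 2: every point of `P^n` has an open neighbourhood over which the cover has a
  -- log-regular model.
  have hloc : ∀ h : (Literature.AlgebraicGeometry.Motives.projectiveSpace n k).left,
      ∃ B : (Literature.AlgebraicGeometry.Motives.projectiveSpace n k).left.Opens, h ∈ B ∧
        ∃ (Y : Scheme.{0}) (π : Y ⟶ ((f ⁻¹ᵁ B : X.Opens) : Scheme.{0})),
          IsProper π ∧ IsBirational π ∧ Scheme.IsLogRegularEtale Y := by
    intro h
    by_cases hh : h ∈ A
    · exact ⟨A, hh, exists_logRegularModel_of_isRegular _ hfAreg⟩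
    · exact hP1 p hp k n X f hint hfin hsurj het h hh
  choose B hhB hB using hloc
  -- Step 3: compactness of `P^n`: finitely many of the `B h` cover.
  obtain ⟨s, hs⟩ := isCompact_univ.elim_finite_subcover
    (fun h => ((B h : (Literature.AlgebraicGeometry.Motives.projectiveSpace n k).left.Opens) :
      Set (Literature.AlgebraicGeometry.Motives.projectiveSpace n k).left))
    (fun h => (B h).2) (fun h _ => Set.mem_iUnion.2 ⟨h, hhB h⟩)
  -- Step 4: patch the models two at a time (induction over the finite subcover of the BASE).
  classical
  have key : ∀ t : Finset (Literature.AlgebraicGeometry.Motives.projectiveSpace n k).left,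
      ∃ (Y : Scheme.{0}) (π : Y ⟶ ((f ⁻¹ᵁ (t.sup B) : X.Opens) : Scheme.{0})),
        IsProper π ∧ IsBirational π ∧ Scheme.IsLogRegularEtale Y := by
    intro t
    induction t using Finset.induction_on with
    | empty =>
      rw [Finset.sup_empty]
      refine exists_logRegularModel_of_isRegular _ (fun z => ?_)
      exact (show False from z.2).elim
    | insert a t hat ih =>
      rw [Finset.sup_insert]
      exact hP3 p hp k n X f hint hfin hsurj het (B a) (t.sup B) (hB a) ih
  -- Step 5: the finite subcover exhausts `P^n`, so its preimage exhausts `X`.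
  have htop : s.sup B = ⊤ := by
    refine top_le_iff.mp fun z _ => ?_
    have hz := hs (Set.mem_univ z)
    simp only [Set.mem_iUnion] at hz
    obtain ⟨i, hi, hzi⟩ := hz
    exact (mem_finset_sup_opens s B z).2 ⟨i, hi, hzi⟩
  have hmodel := key s
  rw [htop, Scheme.Hom.preimage_top] at hmodel
  obtain ⟨Y, π, hπ, hbir, hY⟩ := hmodel
  -- Step 6: `Y` is quasi-compact (proper over the quasi-compact `⊤ ≅ X`), so Nizioł/Kato
  -- resolves it, and the resolution descends along the proper birational `π` and `⊤ ≅ X`.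
  haveI := hπ
  haveI : CompactSpace Y := QuasiCompact.compactSpace_of_compactSpace (π ≫ X.topIso.hom)
  have hYres : Scheme.HasResolution Y := hP2 Y inferInstance hY
  have htopres : Scheme.HasResolution ((⊤ : X.Opens) : Scheme.{0}) :=
    Scheme.HasResolution.of_isBirational π hbir hYres
  exact Scheme.HasResolution.of_iso X.topIso.hom htopres

end Summit.ResolutionOfSingularities.ResolutionOfSingularities.Theorems
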